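import Summits.RiemannHypothesis.RiemannHypothesis.Theses.SignCone
import Literature.NumberTheory.LFunctions.WeilExplicit
import Literature.NumberTheory.LFunctions.WeilExplicitProofs
import Literature.NumberTheory.LFunctions.WeilMellinBounds
import Literature.NumberTheory.LFunctions.WeilWindowSimpleEven
import Literature.NumberTheory.LFunctions.WeilArchimedeanPositivityProofs
import Literature.NumberTheory.LFunctions.WeilFirstPrimePositivityC
import Literature.NumberTheory.LFunctions.WeilExplicitFormulaProofs
import HarnessLib

/-!
# Route SignCone, support item `SignConeUpTo210`: the sign-cone inequality from Weil positivity

Helpers for `Summit.RiemannHypothesis.RiemannHypothesis.Theses.SignCone.SignConeUpTo210`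
(item stmt-RiemannHypothesis-16307): the EXACT prime-free sign-cone inequality
`0 ≤ Re W_ar(F)`, `W_ar = weilPolarTerm + weilArchTerm`, for node-nonnegative tests
`F = Σ_i g_i ⋆ g̃_i` of the Weil cone `P(a)`.

* `re_weilPrimeTerm_nonneg_of_node_nonneg` — for a Weil test `F` with `F(-t) = conj F(t)` and
  `Re F(log n) ≥ 0` (`n ≥ 2`) the prime term `P_Λ(F) = Σ Λ(n) n^{-1/2}(F(log n) + F(-log n))` has
  non-negative real part (each summand is `2 Λ(n) n^{-1/2} Re F(log n) ≥ 0`; `Λ 0 = Λ 1 = 0`).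
* `signConeAt_of_weilPositivityOn` — **the reduction**: `WeilPositivityOn a` implies the exact
  sign-cone inequality at cutoff `a`, because `W_ar(F) = W(F) + P_Λ(F)` with
  `Re W(F) = Σ_i Re Q(g_i) ≥ 0` (additivity of `weilFunctional`) and `Re P_Λ(F) ≥ 0`.
* `signConeAt_of_le_log_three_half` — the UNCONDITIONAL rung `a ≤ (log 3)/2` (supp `F ⊆ [-log 3, log 3]`, the prime
  `2` genuinely present), from the tree's kernel-checked first-prime certificate
  `weilPositivityOn_log_three_half`.
* `SignConeUpTo210_of_weilPositivityOn`, `SignConeUpTo210_of_riemannHypothesis` — the item's exact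
  decl from `WeilPositivityOn ((log 210)/2)`, resp. from `RiemannHypothesis` (explicit formula +
  Weil's criterion direction RH ⇒ positivity, both proved in the tree).

What is NOT here: the unconditional rung `a ≤ (log 210)/2` itself (archive 2001 "Thm S"), which is a
certified ball-arithmetic computation resting on the numerical verification of RH to height
`3·10¹²`; see the item's census.
-/

noncomputable section

-- every Theorems file of this sub-problem declares into `Summit.RiemannHypothesis.RiemannHypothesis.…`
set_option linter.dupNamespace false

open scoped BigOperators ComplexConjugate
open Complex MeasureTheory Set Filter

namespace Summit.RiemannHypothesis.RiemannHypothesis.Theorems.SignCone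

open Literature.NumberTheory.LFunctions

/-! ## Hermitian kernels: the prime term is non-negative on node-nonnegative tests -/

/-- For an arithmetic weight the complex coefficient `Λ(n)/√n` is the real number `Λ(n)/√n`. [folklore] -/
theorem vonMangoldt_div_sqrt_cast (n : ℕ) :
    ((ArithmeticFunction.vonMangoldt n : ℝ) : ℂ) / (Real.sqrt n : ℂ) =
      ((ArithmeticFunction.vonMangoldt n / Real.sqrt n : ℝ) : ℂ) := by
  push_cast
  rfl

/-- **`Re P_Λ(F) ≥ 0` on node-nonnegative hermitian kernels.** If `F(-t) = conj F(t)` for all `t`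
and `Re F(log n) ≥ 0` for every integer `n ≥ 2`, then the prime term
`Σₙ Λ(n) n^{-1/2} (F(log n) + F(-log n))` has non-negative real part: the summand is
`2 Λ(n) n^{-1/2} Re F(log n) ≥ 0` for `n ≥ 2` and vanishes for `n = 0, 1` (`Λ 0 = Λ 1 = 0`).
Hypothesis-free in `F` otherwise (a non-summable series has `tsum = 0`). [folklore] -/
theorem re_weilPrimeTerm_nonneg_of_node_nonneg {F : ℝ → ℂ}
    (hherm : ∀ t : ℝ, F (-t) = conj (F t))
    (hnode : ∀ n : ℕ, 2 ≤ n → 0 ≤ (F (Real.log n)).re) :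
    0 ≤ (weilPrimeTerm F).re := by
  unfold weilPrimeTerm
  set f : ℕ → ℂ := fun n ↦ ((ArithmeticFunction.vonMangoldt n : ℝ) : ℂ) / (Real.sqrt n : ℂ) *
    (F (Real.log n) + F (-Real.log n)) with hf
  have hterm : ∀ n : ℕ, 0 ≤ (f n).re := by
    intro n
    rw [hf]
    dsimp only
    rw [vonMangoldt_div_sqrt_cast, Complex.re_ofReal_mul, Complex.add_re, hherm, Complex.conj_re]
    have hw : 0 ≤ ArithmeticFunction.vonMangoldt n / Real.sqrt n :=
      div_nonneg ArithmeticFunction.vonMangoldt_nonneg (Real.sqrt_nonneg _)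
    rcases lt_or_ge n 2 with hn | hn
    · interval_cases n
      · simp
      · simp [ArithmeticFunction.vonMangoldt_apply_one]
    · have h := hnode n hn
      exact mul_nonneg hw (by linarith)
  by_cases hs : Summable f
  · rw [Complex.re_tsum hs]
    exact tsum_nonneg hterm
  · rw [tsum_eq_zero_of_not_summable hs, Complex.zero_re]

/-- A finite sum of Weil kernels `G_i` with `G_i(-t) = conj G_i(t)` is again hermitian. [folklore] -/
theorem sum_weilConv_weilReflect_neg {k : ℕ} (g : Fin k → ℝ → ℂ) (t : ℝ) :
    (∑ i, weilConv (g i) (weilReflect (g i)) (-t)) = conj (∑ i, weilConv (g i) (weilReflect (g i)) t) := by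
  rw [map_sum]
  refine Finset.sum_congr rfl fun i _ ↦ ?_
  rw [← conj_weilConv_weilReflect_neg (g i) t, Complex.conj_conj]

/-! ## Additivity of the Weil functional over finite sums -/

/-- `W(0) = 0`: every term of the Weil functional of the zero kernel vanishes. [folklore] -/
theorem weilFunctional_zero_fun : weilFunctional (fun _ : ℝ ↦ (0 : ℂ)) = 0 := by
  simp [weilFunctional, weilPolarTerm, weilPrimeTerm, weilArchTerm, weilArchIntegral, weilMellin]

/-- Finite sums of Weil tests are Weil tests. [folklore] -/
theorem isWeilTest_sum {ι : Type*} (s : Finset ι) (G : ι → ℝ → ℂ)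
    (hG : ∀ i ∈ s, IsWeilTest (G i)) : IsWeilTest (fun t ↦ ∑ i ∈ s, G i t) := by
  classical
  induction s using Finset.induction_on with
  | empty =>
    simp only [Finset.sum_empty]
    exact ⟨contDiff_const, HasCompactSupport.zero⟩
  | insert a s ha ih =>
    have e : (fun t ↦ ∑ i ∈ insert a s, G i t) = G a + fun t ↦ ∑ i ∈ s, G i t := by
      funext t
      simp [Finset.sum_insert ha]
    rw [e]
    exact (hG a (Finset.mem_insert_self a s)).add
      (ih fun i hi ↦ hG i (Finset.mem_insert_of_mem hi))

/-- **Additivity of `W` over finite sums of Weil tests**: `W(Σ_{i ∈ s} G_i) = Σ_{i ∈ s} W(G_i)`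
(from `weilFunctional_add`). [folklore] -/
theorem weilFunctional_finset_sum {ι : Type*} (s : Finset ι) (G : ι → ℝ → ℂ)
    (hG : ∀ i ∈ s, IsWeilTest (G i)) :
    weilFunctional (fun t ↦ ∑ i ∈ s, G i t) = ∑ i ∈ s, weilFunctional (G i) := by
  classical
  induction s using Finset.induction_on with
  | empty =>
    simp only [Finset.sum_empty]
    exact weilFunctional_zero_fun
  | insert a s ha ih =>
    have hG' : ∀ i ∈ s, IsWeilTest (G i) := fun i hi ↦ hG i (Finset.mem_insert_of_mem hi)
    have e : (fun t ↦ ∑ i ∈ insert a s, G i t) = G a + fun t ↦ ∑ i ∈ s, G i t := by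
      funext t
      simp [Finset.sum_insert ha]
    rw [e, weilFunctional_add (hG a (Finset.mem_insert_self a s)) (isWeilTest_sum s G hG'), ih hG',
      Finset.sum_insert ha]

/-! ## The reduction: Weil positivity at cutoff `a` ⇒ the exact sign-cone inequality at `a` -/

/-- **Sign cone from Weil positivity.** Let `g_1, …, g_k` be Weil tests supported in `[-a, a]`
and `F = Σ_i g_i ⋆ g̃_i`. If `Re F(log n) ≥ 0` for all `n ≥ 2` and Weil positivity holds on the
cone `K_a` (`WeilPositivityOn a`), then the archimedean-plus-polar part of Weil's functional is
non-negative on `F`: `0 ≤ Re (weilPolarTerm F + weilArchTerm F)`.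
Proof: `W_ar(F) = W(F) + P_Λ(F)`; `Re W(F) = Σ_i Re Q(g_i) ≥ 0` by additivity of `W` and
`WeilPositivityOn a`; `Re P_Λ(F) ≥ 0` by `re_weilPrimeTerm_nonneg_of_node_nonneg`. This is the
direction "RH-type positivity ⇒ (S)" of the 2001 programme (route SignCone thesis: "RH ⇒ X at
once"), at a fixed cutoff. [folklore] -/
theorem signConeAt_of_weilPositivityOn {a : ℝ} (hW : WeilPositivityOn a) {k : ℕ}
    {g : Fin k → ℝ → ℂ} (hg : ∀ i, IsWeilTest (g i) ∧ tsupport (g i) ⊆ Icc (-a) a)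
    (hnode : ∀ n : ℕ, 2 ≤ n →
      0 ≤ ((fun t ↦ ∑ i, weilConv (g i) (weilReflect (g i)) t) (Real.log n)).re) :
    0 ≤ (weilPolarTerm (fun t ↦ ∑ i, weilConv (g i) (weilReflect (g i)) t) +
      weilArchTerm (fun t ↦ ∑ i, weilConv (g i) (weilReflect (g i)) t)).re := by
  set F : ℝ → ℂ := fun t ↦ ∑ i, weilConv (g i) (weilReflect (g i)) t with hF
  have hGi : ∀ i ∈ (Finset.univ : Finset (Fin k)), IsWeilTest (weilConv (g i) (weilReflect (g i))) :=
    fun i _ ↦ (hg i).1.weilConv (hg i).1.weilReflect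
  have hadd : weilFunctional F = ∑ i, weilFunctional (weilConv (g i) (weilReflect (g i))) :=
    weilFunctional_finset_sum Finset.univ _ hGi
  have hW' : 0 ≤ (weilFunctional F).re := by
    rw [hadd, Complex.re_sum]
    exact Finset.sum_nonneg fun i _ ↦ hW (g i) (hg i).1 (hg i).2
  have hherm : ∀ t : ℝ, F (-t) = conj (F t) := fun t ↦ sum_weilConv_weilReflect_neg g t
  have hP : 0 ≤ (weilPrimeTerm F).re := re_weilPrimeTerm_nonneg_of_node_nonneg hherm hnode
  have e : weilPolarTerm F + weilArchTerm F = weilFunctional F + weilPrimeTerm F := by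
    unfold weilFunctional
    ring
  rw [e, Complex.add_re]
  exact add_nonneg hW' hP

/-! ## Rungs in the route's (Mathlib-primitive) statement shape -/

/-- **The unconditional rung `x ≤ 3`** of the sign-cone ladder: for `0 < a ≤ (log 3)/2` (so
`supp F ⊆ [-log 3, log 3]`: the node `log 2` is genuinely inside the support), every
node-nonnegative `F = Σ_i g_i ⋆ g̃_i` of the Weil cone `P(a)` satisfies `0 ≤ Re W_ar(F)`. From the
tree's kernel-checked first-prime Weil positivity `weilPositivityOn_log_three_half` and the
reduction `signConeAt_of_weilPositivityOn`. Stated in the literal shape of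
`SignCone.SignConeUpTo210` with `210` replaced by `3`. [folklore] -/
theorem signConeAt_of_le_log_three_half :
    ∀ a : ℝ, 0 < a → a ≤ Real.log 3 / 2 → ∀ (k : ℕ) (g : Fin k → ℝ → ℂ),
      (∀ i, (ContDiff ℝ ((⊤ : ℕ∞) : WithTop ℕ∞) (g i) ∧ HasCompactSupport (g i)) ∧
        tsupport (g i) ⊆ Set.Icc (-a) a) →
      let F : ℝ → ℂ := fun t => ∑ i, MeasureTheory.convolution (g i)
        (fun u => (starRingEnd ℂ) ((g i) (-u))) (ContinuousLinearMap.mul ℂ ℂ)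
        MeasureTheory.MeasureSpace.volume t
      (∀ n : ℕ, 2 ≤ n → 0 ≤ (F (Real.log n)).re) →
      let M : ℂ → ℂ := fun s => ∫ u : ℝ, F u * Complex.exp ((s - 1 / 2) * u)
      0 ≤ (M 0 + M 1 + ((1 / (2 * Real.pi) : ℂ) * (∫ t : ℝ, M (1 / 2 + t * Complex.I) *
        ((Complex.digamma (1 / 4 + t / 2 * Complex.I)).re : ℂ)) -
        F 0 * (Real.log Real.pi : ℂ))).re := by
  intro a _ hle k g hg F hnode M
  exact signConeAt_of_weilPositivityOn (weilPositivityOn_log_three_half.mono hle) hg hnode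

/-- **`SignConeUpTo210` from Weil positivity at cutoff `(log 210)/2`.** The item's exact decl
follows from `WeilPositivityOn ((log 210)/2)` (monotonicity in the cutoff and
`signConeAt_of_weilPositivityOn`); in particular it is RH-implied
(`SignConeUpTo210_of_riemannHypothesis`). [folklore] -/
theorem SignConeUpTo210_of_weilPositivityOn (h : WeilPositivityOn (Real.log 210 / 2)) :
    Summit.RiemannHypothesis.RiemannHypothesis.Theses.SignCone.SignConeUpTo210 := by
  intro a _ hle k g hg F hnode M
  -- the item was RESTATED (route rev 5) in the slack form `-(F 0).re ≤ Re W_ar(F)`; since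
  -- `F 0 = Σ_i (g_i ⋆ g̃_i)(0) = Σ_i ∫ ‖g_i‖² ≥ 0`, it follows from the exact form `0 ≤ Re W_ar(F)`
  have hF0 : 0 ≤ (F 0).re := by
    have e : F 0 = ∑ i, weilConv (g i) (weilReflect (g i)) 0 := rfl
    rw [e, Complex.re_sum]
    refine Finset.sum_nonneg fun i _ ↦ ?_
    rw [weilConv_weilReflect_apply_zero, Complex.ofReal_re]
    positivity
  exact le_trans (neg_nonpos.mpr hF0) (signConeAt_of_weilPositivityOn (h.mono hle) hg hnode)

/-- **RH ⇒ `SignConeUpTo210`** (the easy direction of the route's thesis, "RH ⇒ X at once"):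
under the Riemann hypothesis Weil positivity holds on every cone (`explicit_formula_holds`,
`WeilPositivityOn.of_riemannHypothesis`), whence the exact sign-cone inequality at every
cutoff `a ≤ (log 210)/2`. [cite: Bombieri2000Weil, Thm 1–2 (RH ⇒ Weil positivity)] -/
theorem SignConeUpTo210_of_riemannHypothesis (hRH : RiemannHypothesis) :
    Summit.RiemannHypothesis.RiemannHypothesis.Theses.SignCone.SignConeUpTo210 :=
  SignConeUpTo210_of_weilPositivityOn
    (WeilPositivityOn.of_riemannHypothesis explicit_formula_holds hRH _)

end Summit.RiemannHypothesis.RiemannHypothesis.Theorems.SignCone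

end
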